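import Mathlib
import HarnessLib
import Summits.HodgeConjecture.HodgeConjecture.Theorems.WeilTypeLadderResidueLemma

/-!
# WeilTypeLadder · LEMMA S: sums of prescribed quadratic residues (the mixed case and the case `n = 2`)

b2b cell `hweil` (packet `run/shared/lean/b2b/hodge-weil/`, reports `b2b-hweil-pv3-g50/RECIPROCITY.md` §4.2 (LEMMA S)
and `b2b-hweil-pv3-g51/NORMFORM.md` §6, prover 3 generations 50–51). PURE FINITE-FIELD ARITHMETIC in `ZMod p`; no
geometry, no named fact, no `decide` census.

THEOREM N of `RECIPROCITY.md` (the exact `N_min` of the series S4) places unit letters in prescribed quadratic-residue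
classes modulo an odd prime `p` with sum zero; its only arithmetic input is LEMMA S: *(n = 3, mixed case) every non-zero
`t ∈ 𝔽_p` is a NON-ZERO SQUARE plus a NON-SQUARE; (n = 2, `p ≡ 3 (mod 4)`) a non-zero square and a non-square can sum
to zero, two non-zero squares or two non-squares cannot.* The equal-class cases of `n = 3` are the tree's
`exists_sq_add_sq_ne_zero_of_seven_le` / `exists_nonsquare_add_nonsquare_of_seven_le` (`WeilTypeLadderResidueLemma`).
This file proves the mixed case for EVERY prime `p ≥ 5` (both residues of `p` mod 4; it is false for `p = 3`) by an
affine-closure argument instead of a character count: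

* `eq_univ_of_sq_mul_mem_of_one_sub_mem` — a non-empty subset of `ZMod p` (`p ≥ 5`) stable under multiplication by
  non-zero squares and under `x ↦ 1 - x` is everything (it is stable under `x ↦ x - 3`, and `3` generates `ZMod p`);
* `exists_sq_one_sub_not_isSquare` — `∃ c ≠ 0`, `1 - c²` a non-square (`p ≥ 5`);
* `exists_not_isSquare_one_sub_isSquare` — `∃ ν` non-square with `1 - ν` a square (`p ≥ 5`);
* `exists_sq_add_nonsquare_of_five_le` — **LEMMA S, mixed case**: every `t ≠ 0` is `a² + b`, `a ≠ 0`, `b` a non-square;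
* `not_isSquare_neg_sq_of_mod_four`, `sq_add_sq_eq_zero_imp_of_mod_four`, `add_ne_zero_of_not_isSquare_of_mod_four`,
  `exists_sq_add_nonsquare_eq_zero_of_mod_four` — **LEMMA S, n = 2** for `p ≡ 3 (mod 4)`.

HONEST LABEL: bookkeeping (elementary, folklore); 0 rungs; nothing of Markman 2025 / Mostaed 2026 / Perry 2026 is
used; no kit job.
-/

-- every declaration of this problem lives in `Summit.HodgeConjecture.HodgeConjecture.…` (summit = sub-problem)
set_option linter.dupNamespace false

namespace Summit.HodgeConjecture.HodgeConjecture.WeilTypeLadder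

/-- **Affine closure.** For a prime `p ≥ 5`, a non-empty subset of `ZMod p` that is stable under multiplication by
non-zero squares and under `x ↦ 1 - x` is all of `ZMod p`: with `4 = 2²` it is stable under
`y ↦ 1 - 4·(1 - y/4) = y - 3`, and `3 ≠ 0` generates `ZMod p` additively. [folklore] -/
theorem eq_univ_of_sq_mul_mem_of_one_sub_mem {p : ℕ} [Fact p.Prime] (hp : 5 ≤ p) {X : Set (ZMod p)}
    (hmul : ∀ s x : ZMod p, s ≠ 0 → x ∈ X → s ^ 2 * x ∈ X) (hsub : ∀ x ∈ X, 1 - x ∈ X) (hne : X.Nonempty) :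
    X = Set.univ := by
  have hk : ∀ k : ℕ, 0 < k → k < p → (k : ZMod p) ≠ 0 := fun k hk hkp h =>
    absurd (Nat.le_of_dvd hk ((ZMod.natCast_eq_zero_iff k p).mp h)) (not_le.mpr hkp)
  have h2 : (2 : ZMod p) ≠ 0 := by exact_mod_cast hk 2 (by norm_num) (by omega)
  have h3 : (3 : ZMod p) ≠ 0 := by exact_mod_cast hk 3 (by norm_num) (by omega)
  -- the translation `y ↦ y - 3` preserves `X`
  have hT : ∀ y ∈ X, y - 3 ∈ X := by
    intro y hy
    have h1 : (2⁻¹ : ZMod p) ^ 2 * y ∈ X := hmul _ _ (inv_ne_zero h2) hy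
    have h2' : 1 - (2⁻¹ : ZMod p) ^ 2 * y ∈ X := hsub _ h1
    have h3' : (2 : ZMod p) ^ 2 * (1 - (2⁻¹ : ZMod p) ^ 2 * y) ∈ X := hmul _ _ h2 h2'
    have h4' : 1 - (2 : ZMod p) ^ 2 * (1 - (2⁻¹ : ZMod p) ^ 2 * y) ∈ X := hsub _ h3'
    have : 1 - (2 : ZMod p) ^ 2 * (1 - (2⁻¹ : ZMod p) ^ 2 * y) = y - 3 := by
      have : (2 : ZMod p) * 2⁻¹ = 1 := mul_inv_cancel₀ h2
      linear_combination (y * ((2 : ZMod p) * 2⁻¹) + y) * this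
    rwa [this] at h4'
  -- hence every iterate
  have hiter : ∀ y ∈ X, ∀ k : ℕ, y - 3 * (k : ZMod p) ∈ X := by
    intro y hy k
    induction k with
    | zero => simpa using hy
    | succ k ih =>
      have := hT _ ih
      have e : y - 3 * (k : ZMod p) - 3 = y - 3 * ((k + 1 : ℕ) : ZMod p) := by push_cast; ring
      rwa [e] at this
  obtain ⟨y, hy⟩ := hne
  apply Set.eq_univ_of_forall
  intro z
  -- z = y - 3 w with w = (y - z)/3, and w is the cast of its own `val`
  set w : ZMod p := (y - z) * 3⁻¹ with hw
  have := hiter y hy w.val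
  have e : y - 3 * ((w.val : ℕ) : ZMod p) = z := by
    rw [ZMod.natCast_zmod_val, hw]
    have : (3 : ZMod p) * 3⁻¹ = 1 := mul_inv_cancel₀ h3
    linear_combination (z - y) * this
  rwa [e] at this

/-- For a prime `p ≥ 5` there is `c ≠ 0` in `ZMod p` with `1 - c²` a NON-square (false for `p = 3`). Otherwise the set of
squares would be stable under `x ↦ 1 - x` and under multiplication by squares, hence everything. [folklore] -/
theorem exists_sq_one_sub_not_isSquare {p : ℕ} [Fact p.Prime] (hp : 5 ≤ p) :
    ∃ c : ZMod p, c ≠ 0 ∧ ¬IsSquare (1 - c ^ 2) := by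
  by_contra hcon
  push Not at hcon
  have hchar : ringChar (ZMod p) ≠ 2 := by
    rw [ZMod.ringChar_zmod_n]
    omega
  obtain ⟨n, hn⟩ := FiniteField.exists_nonsquare hchar
  have huniv : {x : ZMod p | IsSquare x} = Set.univ := by
    refine eq_univ_of_sq_mul_mem_of_one_sub_mem hp ?_ ?_ ⟨0, ⟨0, by simp⟩⟩
    · intro s x _ hx
      exact (IsSquare.sq s).mul hx
    · rintro x ⟨r, rfl⟩
      by_cases hr : r = 0
      · subst hr; exact ⟨1, by simp⟩
      · simpa [pow_two] using hcon r hr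
  have : n ∈ {x : ZMod p | IsSquare x} := by rw [huniv]; trivial
  exact hn this

/-- For a prime `p ≥ 5` there is a NON-square `ν` in `ZMod p` with `1 - ν` a square. Otherwise the set of non-squares
would be stable under `x ↦ 1 - x` and under multiplication by non-zero squares, hence everything. [folklore] -/
theorem exists_not_isSquare_one_sub_isSquare {p : ℕ} [Fact p.Prime] (hp : 5 ≤ p) :
    ∃ ν : ZMod p, ¬IsSquare ν ∧ IsSquare (1 - ν) := by
  by_contra hcon
  push Not at hcon
  have hchar : ringChar (ZMod p) ≠ 2 := by
    rw [ZMod.ringChar_zmod_n]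
    omega
  obtain ⟨n, hn⟩ := FiniteField.exists_nonsquare hchar
  have huniv : {x : ZMod p | ¬IsSquare x} = Set.univ := by
    refine eq_univ_of_sq_mul_mem_of_one_sub_mem hp ?_ ?_ ⟨n, hn⟩
    · intro s x hs hx
      rw [mul_comm]
      exact not_isSquare_mul_sq hx hs
    · intro x hx
      exact hcon x hx
  have : (0 : ZMod p) ∈ {x : ZMod p | ¬IsSquare x} := by rw [huniv]; trivial
  exact this ⟨0, by simp⟩

/-- **LEMMA S, mixed case** ([P3-g50] 4.2 (a), `n = 3` with different classes): for a prime `p ≥ 5` every non-zero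
`t ∈ ZMod p` is `a² + b` with `a ≠ 0` and `b` a NON-square. (For `t = d²`: `a = c d`, `b = d²(1 - c²)` with `c` from
`exists_sq_one_sub_not_isSquare`; for `t` a non-square: `ν t = r²` with `ν` from
`exists_not_isSquare_one_sub_isSquare`, `a = r`, `b = t (1 - ν)`.) [folklore] -/
theorem exists_sq_add_nonsquare_of_five_le {p : ℕ} [Fact p.Prime] (hp : 5 ≤ p) {t : ZMod p} (ht : t ≠ 0) :
    ∃ a b : ZMod p, a ≠ 0 ∧ ¬IsSquare b ∧ t = a ^ 2 + b := by
  by_cases hsq : IsSquare t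
  · obtain ⟨d, rfl⟩ := hsq
    have hd : d ≠ 0 := by rintro rfl; exact ht (by simp)
    obtain ⟨c, hc, hnc⟩ := exists_sq_one_sub_not_isSquare hp
    refine ⟨c * d, (1 - c ^ 2) * d ^ 2, mul_ne_zero hc hd, not_isSquare_mul_sq hnc hd, by ring⟩
  · obtain ⟨ν, hν, ⟨g, hg⟩⟩ := exists_not_isSquare_one_sub_isSquare hp
    have hν0 : ν ≠ 0 := by rintro rfl; exact hν ⟨0, by simp⟩
    have hg0 : g ≠ 0 := by
      rintro rfl
      apply hν
      exact ⟨1, by linear_combination (-1 : ZMod p) * hg⟩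
    -- the product of two non-squares is a square (quadratic character)
    have hprod : IsSquare (ν * t) := by
      have h1 : quadraticChar (ZMod p) ν = -1 := quadraticChar_neg_one_iff_not_isSquare.mpr hν
      have h2 : quadraticChar (ZMod p) t = -1 := quadraticChar_neg_one_iff_not_isSquare.mpr hsq
      have h3 : quadraticChar (ZMod p) (ν * t) = 1 := by rw [map_mul, h1, h2]; norm_num
      exact (quadraticChar_one_iff_isSquare (mul_ne_zero hν0 ht)).mp h3
    obtain ⟨r, hr⟩ := hprod
    have hr0 : r ≠ 0 := by
      rintro rfl
      exact mul_ne_zero hν0 ht (by simpa using hr)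
    refine ⟨r, t * g ^ 2, hr0, not_isSquare_mul_sq hsq hg0, ?_⟩
    linear_combination hr + t * hg

/-- `n = 2`, first half: for `p ≡ 3 (mod 4)` and `a ≠ 0`, `-a²` is a NON-square (so two non-zero squares never sum to
zero). [folklore; Mathlib's `ZMod.exists_sq_eq_neg_one_iff`] -/
theorem not_isSquare_neg_sq_of_mod_four {p : ℕ} [Fact p.Prime] (hp4 : p % 4 = 3) {a : ZMod p} (ha : a ≠ 0) :
    ¬IsSquare (-a ^ 2) := by
  have h1 : ¬IsSquare (-1 : ZMod p) := by
    rw [ZMod.exists_sq_eq_neg_one_iff]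
    exact fun h => h hp4
  have : (-a ^ 2 : ZMod p) = -1 * a ^ 2 := by ring
  rw [this]
  exact not_isSquare_mul_sq h1 ha

/-- `n = 2`: for `p ≡ 3 (mod 4)`, `a² + b² = 0` forces `a = b = 0`. [folklore; Mathlib's
`ZMod.mod_four_ne_three_of_sq_eq_neg_sq'`] -/
theorem sq_add_sq_eq_zero_imp_of_mod_four {p : ℕ} [Fact p.Prime] (hp4 : p % 4 = 3) {a b : ZMod p}
    (h : a ^ 2 + b ^ 2 = 0) : a = 0 ∧ b = 0 := by
  by_cases hb : b = 0
  · subst hb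
    refine ⟨?_, rfl⟩
    have : a ^ 2 = 0 := by simpa using h
    exact pow_eq_zero_iff (n := 2) (by norm_num) |>.mp this
  · exfalso
    exact ZMod.mod_four_ne_three_of_sq_eq_neg_sq' (x := a) hb (by linear_combination h) hp4

/-- `n = 2`: for `p ≡ 3 (mod 4)` two NON-squares never sum to zero (`v = -u = (-1)·u` would be a square, as `-1` is a
non-square). [folklore] -/
theorem add_ne_zero_of_not_isSquare_of_mod_four {p : ℕ} [Fact p.Prime] (hp4 : p % 4 = 3) {u v : ZMod p}
    (hu : ¬IsSquare u) (hv : ¬IsSquare v) : u + v ≠ 0 := by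
  intro h
  have hu0 : u ≠ 0 := by rintro rfl; exact hu ⟨0, by simp⟩
  have h1 : ¬IsSquare (-1 : ZMod p) := by
    rw [ZMod.exists_sq_eq_neg_one_iff]
    exact fun h' => h' hp4
  have c1 : quadraticChar (ZMod p) (-1) = -1 := quadraticChar_neg_one_iff_not_isSquare.mpr h1
  have cu : quadraticChar (ZMod p) u = -1 := quadraticChar_neg_one_iff_not_isSquare.mpr hu
  have hvu : v = -1 * u := by linear_combination h
  have cv : quadraticChar (ZMod p) v = 1 := by rw [hvu, map_mul, c1, cu]; norm_num
  have hv0 : v ≠ 0 := by rintro rfl; exact hv ⟨0, by simp⟩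
  exact hv ((quadraticChar_one_iff_isSquare hv0).mp cv)

/-- `n = 2`, the admissible configuration: for `p ≡ 3 (mod 4)` a non-zero square and a non-square CAN sum to zero
(`1 + (-1) = 0`). Together with the two preceding statements: prescribed classes `C₊^{n₊} × C₋^{n₋}` with `n₊ + n₋ = 2`
contain a zero-sum pair iff `n₊ = n₋ = 1` — LEMMA S (a)/(b) for `n = 2`. [folklore] -/
theorem exists_sq_add_nonsquare_eq_zero_of_mod_four {p : ℕ} [Fact p.Prime] (hp4 : p % 4 = 3) :
    ∃ x y : ZMod p, x ≠ 0 ∧ IsSquare x ∧ ¬IsSquare y ∧ x + y = 0 := by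
  refine ⟨1, -1, one_ne_zero, ⟨1, by simp⟩, ?_, by ring⟩
  have := not_isSquare_neg_sq_of_mod_four hp4 (one_ne_zero : (1 : ZMod p) ≠ 0)
  simpa using this

end Summit.HodgeConjecture.HodgeConjecture.WeilTypeLadder
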